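import Literature.MathematicalPhysics.QuantumFieldTheory.ConformalBootstrap3D.MixedBlockLeadingTrajectory
import Literature.MathematicalPhysics.QuantumFieldTheory.ConformalBootstrap3D.BlockExistenceLimit
import Literature.MathematicalPhysics.QuantumFieldTheory.ConformalBootstrap3D.BlockExistenceAB
import Mathlib.Analysis.Analytic.Binomial
import Mathlib.Tactic
import HarnessLib

/-!
# The conformal block decomposition of the free massless scalar four-point function in `d = 3`

The free massless scalar `φ` in three dimensions (`Δ_φ = 1/2`) has
`⟨φφφφ⟩ = (x₁₂² x₃₄²)^{-1/2} 𝒢(u,v)`, `𝒢(u,v) = 1 + u^{1/2} + (u/v)^{1/2}`, and `φ × φ` contains, besides the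
identity, exactly `φ²` (`Δ = 1`, `ℓ = 0`) and the conserved currents `J_ℓ = φ ∂^ℓ φ` (`Δ = ℓ + 1`, `ℓ`
even, `ℓ ≥ 2`; `J_2` the stress tensor) — operators AT the unitarity bound. This file PROVES the
decomposition of `𝒢 - 1` into the typed blocks `hrBlock (ℓ+1) ℓ` of the `σ–ε` system
(`BlockExistence`, `BlockExistenceLimit`: at `Δ = ℓ + 1`, `ℓ ≥ 1`, and at `(1, 0)` these ARE blocks in the
sense of `IsConformalBlock3D 0 0`), with explicit positive coefficients, as a `HasSum` identity on the open
square `z, z̄ ∈ (0,1)`: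

  `𝒢(z,z̄) - 1 = Σ_{m ≥ 0} λ²_{2m} g_{2m+1,2m}(z,z̄)`, `λ²_0 = 2`, `λ²_{2m} = 4 λ_{2m} / 4^{2m}` (`m ≥ 1`),

`λ_i = C(2i,i)/4^i` (`hasSum_freeScalar_blocks`, `freeScalarOPECoeffSq`; `λ²_2 = 3/32` for the stress
tensor). These are the mean-field-theory coefficients of Fitzpatrick–Kaplan 2012 §2.2,
`2 (Δ_φ)_ℓ² / (ℓ! (2Δ_φ+ℓ-1)_ℓ)` at `Δ_φ = 1/2`, `d = 3`, leading twist only (the higher twist families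
carry the factor `(Δ_φ - d/2 + 1)_n = (0)_n = 0`), in the normalisation `k_{ℓ,0} = 1` of the typed blocks.

## Proof

1. At `Δ = ℓ + 1` the `z`-series coefficients lie on Dolan–Osborn's line `λ₂ = 1/2`: the block is a single
   Legendre trajectory, `A_{n,j}(ℓ+1,ℓ) = 0` for `j ≠ ℓ+n` (`MixedBlockLeadingTrajectory`) and
   `A_{n,ℓ+n}(ℓ+1,ℓ) = C(2ℓ+2n,n)/4^n` (`hrCoeff_bound_leading`), so
   `k^{(ℓ)}_{ik} = [ℓ ≤ i+k] A_{i+k-ℓ, i+k}/λ_ℓ · λ_i λ_k` (`hrMonomialCoeff_bound`): bounded, non-negative,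
   summable against `z^i z̄^k` on the bidisk (`hasSum_hrSeries_bound`).
2. `Σ_i λ_i x^i = (1-x)^{-1/2}` (Mathlib's binomial series; `hasSum_legendreLam_mul_pow`).
3. Comparing the coefficient of `λ_i λ_k z^i z̄^k`, `i + k = N`, the decomposition is EQUIVALENT to the family
   of identities `Σ_{2m ≤ N} λ²_{2m} A_{N-2m,N}(2m+1,2m)/λ_{2m} = 1 + δ_{N,0}`, i.e.
   `Σ_{2m ≤ N} c_m C(2N, N-2m) = 4^N (1 + δ_{N,0})`, `c_0 = 2`, `c_m = 4`, i.e. (folding `C(2N,N±x)`) the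
   binomial parity identity `Σ_{j ≡ N (mod 2)} C(2N, j) = 2^{2N-1}` (`freeScalar_degree_identity`).
4. Tonelli on the non-negative family `λ²_{2m} k^{(2m)}_{ik} z^i z̄^k` on `(ℕ × ℕ) × ℕ`
   (`summable_prod_of_nonneg`, `HasSum.prod_fiberwise` in both orders) gives
   `Σ_m λ²_{2m} K_{2m+1,2m}(z,z̄) = 1 + (1-z)^{-1/2}(1-z̄)^{-1/2}` (`hasSum_freeScalar_series`), and multiplying
   by `(z z̄)^{1/2}` the block form.

In print the free-field coefficients are obtained by conglomeration (Fitzpatrick–Kaplan 2012 §2.2) or, in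
`d = 4`, "verified … for the first 20 terms" (Dolan–Osborn 2001 §6); here the `d = 3` decomposition is a
theorem about the typed objects of the tree. It is the input of the non-vacuity witness for the
single-correlator hypothesis set (`SingleCorrelatorNonVacuity`).

References: F. A. Dolan, H. Osborn, arXiv:1108.6194, §6 eqs. (6.17)–(6.20) [cite: DolanOsborn2011, §6 eq. (6.20)];
A. L. Fitzpatrick, J. Kaplan, JHEP 10 (2012) 032, §2.2 (mean field theory coefficients `(c̄_{n,ℓ})²`)
[cite: FitzpatrickKaplan2012, §2.2]; M. Hogervorst, S. Rychkov, JHEP 06 (2013) 106, §2.1 eq. (2.16)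
[cite: HogervorstRychkov2013, §2.1 eq. (2.16)]. Mathlib: `Real.one_div_one_sub_rpow_hasFPowerSeriesOnBall_zero`,
`summable_prod_of_nonneg`, `HasSum.prod_fiberwise`, `Int.alternating_sum_range_choose_of_ne`.
-/

namespace Literature.MathematicalPhysics.QuantumFieldTheory.ConformalBootstrap3D

open Finset Set Filter Topology

/-! ### 1. The generating function `Σ_i λ_i x^i = (1 - x)^{-1/2}` -/

/-- `Ring.choose y k = ∏_{j<k} (y - j) / k!`. [folklore] -/
private theorem ring_choose_eq_prod_div (y : ℝ) (k : ℕ) :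
    Ring.choose y k = (∏ j ∈ range k, (y - j)) / (Nat.factorial k : ℝ) := by
  rw [Ring.choose_eq_smul, ← Polynomial.aeval_eq_smeval, Polynomial.aeval_def,
    Polynomial.eval₂_eq_eval_map, descPochhammer_map, descPochhammer_eval_eq_prod_range,
    smul_eq_mul, div_eq_inv_mul]

/-- The generalized binomial coefficient `C(n - 1/2, n) = (1/2)_n / n! = λ_n = C(2n,n)/4^n`. [folklore] -/
theorem ring_choose_half_eq_legendreLam (n : ℕ) :
    Ring.choose ((1 : ℝ) / 2 + n - 1) n = legendreLam n := by
  rw [ring_choose_eq_prod_div]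
  induction n with
  | zero => simp
  | succ n ih =>
    rw [legendreLam_succ, ← ih, prod_range_succ', Nat.factorial_succ]
    have hprod : ∏ j ∈ range n, ((1 : ℝ) / 2 + ((n + 1 : ℕ) : ℝ) - 1 - ((j + 1 : ℕ) : ℝ)) =
        ∏ j ∈ range n, ((1 : ℝ) / 2 + (n : ℝ) - 1 - (j : ℝ)) := by
      refine prod_congr rfl fun j _ => ?_
      push_cast
      ring
    rw [hprod]
    have hf : (Nat.factorial n : ℝ) ≠ 0 := by positivity
    push_cast
    field_simp
    ring

/-- **`Σ_i λ_i x^i = (1 - x)^{-1/2}`** for `|x| < 1` (the binomial series; `λ_i = C(2i,i)/4^i` are the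
Taylor coefficients of `(1 - x)^{-1/2}`, equivalently `P_j(cos θ) = Σ_{i+r=j} λ_i λ_r e^{i(i-r)θ}`).
Mathlib: `Real.one_div_one_sub_rpow_hasFPowerSeriesOnBall_zero`. [folklore] -/
theorem hasSum_legendreLam_mul_pow {x : ℝ} (hx : |x| < 1) :
    HasSum (fun n => legendreLam n * x ^ n) (1 / (1 - x) ^ ((1 : ℝ) / 2)) := by
  have hmem : x ∈ Metric.eball (0 : ℝ) 1 := by
    rw [Metric.mem_eball, edist_zero_right, ← ofReal_norm, Real.norm_eq_abs]
    exact ENNReal.ofReal_lt_one.mpr hx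
  have h := (Real.one_div_one_sub_rpow_hasFPowerSeriesOnBall_zero ((1 : ℝ) / 2)).hasSum hmem
  simp only [zero_add, FormalMultilinearSeries.ofScalars_apply_eq, smul_eq_mul,
    ring_choose_half_eq_legendreLam] at h
  exact h

/-! ### 2. The leading trajectory at the unitarity bound: `A_{n,ℓ+n}(ℓ+1, ℓ) = C(2ℓ+2n, n)/4^n` -/

/-- `(n+1)(2ℓ+n+1) C(2ℓ+2n+2, n+1) = (2ℓ+2n+2)(2ℓ+2n+1) C(2ℓ+2n, n)`. [folklore] -/
private theorem choose_bound_step (ℓ n : ℕ) :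
    (n + 1) * (2 * ℓ + n + 1) * (2 * ℓ + 2 * n + 2).choose (n + 1) =
      (2 * ℓ + 2 * n + 2) * (2 * ℓ + 2 * n + 1) * (2 * ℓ + 2 * n).choose n := by
  have h1 : (2 * ℓ + 2 * n + 2) * (2 * ℓ + 2 * n + 1).choose n =
      (2 * ℓ + 2 * n + 2).choose (n + 1) * (n + 1) := Nat.add_one_mul_choose_eq (2 * ℓ + 2 * n + 1) n
  have h2 := Nat.choose_mul_succ_eq (2 * ℓ + 2 * n) n
  have h3 : 2 * ℓ + 2 * n + 1 - n = 2 * ℓ + n + 1 := by omega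
  rw [h3] at h2
  calc (n + 1) * (2 * ℓ + n + 1) * (2 * ℓ + 2 * n + 2).choose (n + 1)
      = (2 * ℓ + n + 1) * ((2 * ℓ + 2 * n + 2).choose (n + 1) * (n + 1)) := by ring
    _ = (2 * ℓ + n + 1) * ((2 * ℓ + 2 * n + 2) * (2 * ℓ + 2 * n + 1).choose n) := by rw [h1]
    _ = (2 * ℓ + 2 * n + 2) * ((2 * ℓ + 2 * n).choose n * (2 * ℓ + 2 * n + 1)) := by
        rw [h2]; ring
    _ = (2 * ℓ + 2 * n + 2) * (2 * ℓ + 2 * n + 1) * (2 * ℓ + 2 * n).choose n := by ring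

/-- **The block at the unitarity bound is a single Legendre trajectory**: at `Δ = ℓ + 1` (equal external
dimensions) every coefficient off the leading trajectory vanishes, `A_{n,j}(ℓ+1, ℓ) = 0` for `j ≠ ℓ + n`
(Dolan–Osborn's line `λ₂ = 1/2`, `MixedBlockLeadingTrajectory`). [cite: DolanOsborn2011, §6 eqs. (6.17)–(6.20)] -/
theorem hrCoeff_bound_eq_zero_of_ne (ℓ : ℕ) {n j : ℕ} (hj : j ≠ ℓ + n) :
    hrCoeff ((ℓ : ℝ) + 1) ℓ n j = 0 := by
  rw [← hrCoeffAB_zero_zero]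
  exact hrCoeffAB_eq_zero_of_line (a := 0) (b := 0) (by ring) n j hj

/-- **The leading trajectory at the bound in closed form**: `A_{n,ℓ+n}(ℓ+1, ℓ) = C(2ℓ+2n, n)/4^n`
(`= (ℓ+1/2)_n (ℓ+1)_n / (n! (2ℓ+1)_n)`, the Taylor coefficients of Dolan–Osborn's
`X^ℓ ₂F₁(ℓ+1/2, ℓ+1; 2ℓ+1; X)`). [cite: DolanOsborn2011, §6 eq. (6.20)] -/
theorem hrCoeff_bound_leading (ℓ n : ℕ) :
    hrCoeff ((ℓ : ℝ) + 1) ℓ n (ℓ + n) = ((2 * ℓ + 2 * n).choose n : ℝ) / 4 ^ n := by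
  rw [← hrCoeffAB_zero_zero, hrCoeffAB_leading_of_line (a := 0) (b := 0) (by ring)]
  induction n with
  | zero => simp
  | succ n ih =>
    rw [prod_range_succ, ih]
    have h := choose_bound_step ℓ n
    have h' : ((n : ℝ) + 1) * (2 * ℓ + n + 1) * ((2 * ℓ + 2 * n + 2).choose (n + 1) : ℝ) =
        (2 * ℓ + 2 * n + 2) * (2 * ℓ + 2 * n + 1) * ((2 * ℓ + 2 * n).choose n : ℝ) := by
      exact_mod_cast h
    have e1 : 2 * ℓ + 2 * (n + 1) = 2 * ℓ + 2 * n + 2 := by ring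
    rw [e1]
    have hd1 : (2 : ℝ) * ((n : ℝ) + 1) * ((ℓ : ℝ) + 1 + ℓ + n) ≠ 0 := by positivity
    have hd2 : ((n : ℝ) + 1) * (2 * ℓ + n + 1) ≠ 0 := by positivity
    rw [div_mul_div_comm, div_eq_div_iff (by positivity) (by positivity)]
    have : ((2 * ℓ + 2 * n + 2).choose (n + 1) : ℝ) =
        (2 * ℓ + 2 * n + 2) * (2 * ℓ + 2 * n + 1) * ((2 * ℓ + 2 * n).choose n : ℝ) /
          (((n : ℝ) + 1) * (2 * ℓ + n + 1)) := by
      rw [eq_div_iff hd2]; linear_combination h'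
    rw [this]
    field_simp
    ring

/-- `e_{N,N}(p) = λ_{p₁} λ_{p₂}` on the antidiagonal `p₁ + p₂ = N`. [folklore] -/
theorem legendreArrDeg_self {N : ℕ} {p : ℕ × ℕ} (h : p.1 + p.2 = N) :
    legendreArrDeg N N p = legendreLam p.1 * legendreLam p.2 := by
  obtain ⟨i, k⟩ := p
  unfold legendreArrDeg
  rw [if_pos ⟨le_rfl, by omega⟩, Nat.sub_self, Nat.zero_div]
  exact legendreArr_pair 0 N i k i k (by simp) (by simp) h

/-- **The double-series coefficients of the block at the bound**: for `Δ = ℓ + 1`,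
`k_{p} = [ℓ ≤ |p|] · A_{|p|-ℓ, |p|}(ℓ+1,ℓ)/λ_ℓ · λ_{p₁} λ_{p₂}` (one Legendre trajectory).
[cite: DolanOsborn2011, §6 eq. (6.20)] -/
theorem hrMonomialCoeff_bound (ℓ : ℕ) (p : ℕ × ℕ) :
    hrMonomialCoeff ((ℓ : ℝ) + 1) ℓ p =
      if ℓ ≤ p.1 + p.2 then
        hrCoeff ((ℓ : ℝ) + 1) ℓ (p.1 + p.2 - ℓ) (p.1 + p.2) / legendreLam ℓ *
          (legendreLam p.1 * legendreLam p.2)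
      else 0 := by
  unfold hrMonomialCoeff
  split_ifs with h
  · unfold hrSlice
    rw [sum_eq_single_of_mem (p.1 + p.2) (mem_range.mpr (by omega))]
    · rw [legendreArrDeg_self rfl]
    · intro j _ hne
      rw [hrCoeff_bound_eq_zero_of_ne ℓ (by omega), zero_div, zero_mul]
  · rfl

/-- The coefficients at the bound are non-negative. [folklore] -/
theorem hrMonomialCoeff_bound_nonneg (ℓ : ℕ) (p : ℕ × ℕ) : 0 ≤ hrMonomialCoeff ((ℓ : ℝ) + 1) ℓ p := by
  rw [hrMonomialCoeff_bound]
  split_ifs with h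
  · obtain ⟨n, hn⟩ := Nat.exists_eq_add_of_le h
    have e : p.1 + p.2 - ℓ = n := by omega
    rw [e, hn, hrCoeff_bound_leading]
    exact mul_nonneg (div_nonneg (by positivity) (legendreLam_pos ℓ).le)
      (mul_nonneg (legendreLam_pos _).le (legendreLam_pos _).le)
  · exact le_rfl

/-- The coefficients at the bound are bounded: `k_p ≤ 4^ℓ/λ_ℓ` (`C(2N, N-ℓ) ≤ 4^N`, `λ_i ≤ 1`). [folklore] -/
theorem hrMonomialCoeff_bound_le (ℓ : ℕ) (p : ℕ × ℕ) :
    hrMonomialCoeff ((ℓ : ℝ) + 1) ℓ p ≤ 4 ^ ℓ / legendreLam ℓ := by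
  have hlam := legendreLam_pos ℓ
  rw [hrMonomialCoeff_bound]
  split_ifs with h
  · obtain ⟨n, hn⟩ := Nat.exists_eq_add_of_le h
    have e : p.1 + p.2 - ℓ = n := by omega
    rw [e, hn, hrCoeff_bound_leading]
    have hch : ((2 * ℓ + 2 * n).choose n : ℝ) ≤ 4 ^ ℓ * 4 ^ n := by
      have := Nat.choose_le_two_pow (2 * ℓ + 2 * n) n
      have h' : ((2 * ℓ + 2 * n).choose n : ℝ) ≤ (2 : ℝ) ^ (2 * ℓ + 2 * n) := by exact_mod_cast this
      calc ((2 * ℓ + 2 * n).choose n : ℝ) ≤ (2 : ℝ) ^ (2 * ℓ + 2 * n) := h'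
        _ = 4 ^ ℓ * 4 ^ n := by
            rw [pow_add, pow_mul, pow_mul]; norm_num
    have hll : legendreLam p.1 * legendreLam p.2 ≤ 1 := by
      calc legendreLam p.1 * legendreLam p.2 ≤ 1 * 1 :=
            mul_le_mul (legendreLam_le_one _) (legendreLam_le_one _) (legendreLam_pos _).le zero_le_one
        _ = 1 := one_mul 1
    have h4n : (0 : ℝ) < 4 ^ n := by positivity
    calc ((2 * ℓ + 2 * n).choose n : ℝ) / 4 ^ n / legendreLam ℓ * (legendreLam p.1 * legendreLam p.2)
        ≤ (4 ^ ℓ * 4 ^ n) / 4 ^ n / legendreLam ℓ * 1 :=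
          mul_le_mul (div_le_div_of_nonneg_right (div_le_div_of_nonneg_right hch h4n.le) hlam.le) hll
            (mul_nonneg (legendreLam_pos _).le (legendreLam_pos _).le)
            (div_nonneg (div_nonneg (by positivity) h4n.le) hlam.le)
      _ = 4 ^ ℓ / legendreLam ℓ := by
          rw [mul_one, mul_div_assoc, div_self h4n.ne', mul_one]
  · positivity

/-- **The `z`-series of the block at the bound converges absolutely on the open unit bidisk** (bounded
coefficients against a double geometric series) and `hrSeries (ℓ+1) ℓ` is its sum. [cite: HogervorstRychkov2013, §2.1 eq. (2.16)] -/
theorem hasSum_hrSeries_bound (ℓ : ℕ) {z zb : ℝ} (hz : z ∈ Ioo (0 : ℝ) 1) (hzb : zb ∈ Ioo (0 : ℝ) 1) :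
    HasSum (fun p : ℕ × ℕ => hrMonomialCoeff ((ℓ : ℝ) + 1) ℓ p * z ^ p.1 * zb ^ p.2)
      (hrSeries ((ℓ : ℝ) + 1) ℓ z zb) := by
  have hgeo : Summable fun p : ℕ × ℕ => z ^ p.1 * zb ^ p.2 :=
    (summable_geometric_of_lt_one hz.1.le hz.2).mul_of_nonneg (summable_geometric_of_lt_one hzb.1.le hzb.2)
      (fun _ => pow_nonneg hz.1.le _) (fun _ => pow_nonneg hzb.1.le _)
  have hsum : Summable fun p : ℕ × ℕ => hrMonomialCoeff ((ℓ : ℝ) + 1) ℓ p * z ^ p.1 * zb ^ p.2 := by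
    refine (hgeo.mul_left (4 ^ ℓ / legendreLam ℓ)).of_nonneg_of_le (fun p => ?_) (fun p => ?_)
    · exact mul_nonneg (mul_nonneg (hrMonomialCoeff_bound_nonneg ℓ p) (pow_nonneg hz.1.le _))
        (pow_nonneg hzb.1.le _)
    · rw [mul_assoc]
      exact mul_le_mul_of_nonneg_right (hrMonomialCoeff_bound_le ℓ p)
        (mul_nonneg (pow_nonneg hz.1.le _) (pow_nonneg hzb.1.le _))
  exact hsum.hasSum

/-! ### 3. The binomial parity identity behind the decomposition -/

/-- `Σ_{j ≤ n} [j even] C(n,j) = Σ_{j ≤ n} [j odd] C(n,j)` for `n ≥ 1` (from `Σ_j (-1)^j C(n,j) = 0`). [folklore] -/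
private theorem sum_even_choose_eq_sum_odd {n : ℕ} (hn : n ≠ 0) :
    ∑ j ∈ range (n + 1), (if j % 2 = 0 then (n.choose j : ℝ) else 0) =
      ∑ j ∈ range (n + 1), (if j % 2 = 0 then 0 else (n.choose j : ℝ)) := by
  have h := Int.alternating_sum_range_choose_of_ne hn
  have h' : ∑ j ∈ range (n + 1), ((-1 : ℝ) ^ j * (n.choose j : ℝ)) = 0 := by exact_mod_cast h
  have key : ∑ j ∈ range (n + 1),
      ((if j % 2 = 0 then (n.choose j : ℝ) else 0) - (if j % 2 = 0 then 0 else (n.choose j : ℝ))) =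
      ∑ j ∈ range (n + 1), ((-1 : ℝ) ^ j * (n.choose j : ℝ)) := by
    refine sum_congr rfl fun j _ => ?_
    split_ifs with hj
    · rw [(Nat.even_iff.mpr hj).neg_one_pow]; ring
    · rw [(Nat.odd_iff.mpr (by omega)).neg_one_pow]; ring
  rw [← sub_eq_zero, ← sum_sub_distrib, key, h']

/-- `Σ_{j ≤ 2N} [j ≡ N (mod 2)] C(2N, j) = 2^{2N-1}` for `N ≥ 1` (half of `2^{2N}`, whichever the parity). [folklore] -/
private theorem sum_parity_choose {N : ℕ} (hN : N ≠ 0) :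
    ∑ j ∈ range (2 * N + 1), (if j % 2 = N % 2 then ((2 * N).choose j : ℝ) else 0) =
      2 ^ (2 * N - 1) := by
  have htot : ∑ j ∈ range (2 * N + 1), ((2 * N).choose j : ℝ) = 2 ^ (2 * N) := by
    exact_mod_cast Nat.sum_range_choose (2 * N)
  have hsplit : ∑ j ∈ range (2 * N + 1), ((2 * N).choose j : ℝ) =
      ∑ j ∈ range (2 * N + 1), (if j % 2 = 0 then ((2 * N).choose j : ℝ) else 0) +
        ∑ j ∈ range (2 * N + 1), (if j % 2 = 0 then 0 else ((2 * N).choose j : ℝ)) := by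
    rw [← sum_add_distrib]
    exact sum_congr rfl fun j _ => by split_ifs <;> simp
  have heo := sum_even_choose_eq_sum_odd (n := 2 * N) (by omega)
  have hpow : (2 : ℝ) ^ (2 * N) = 2 * 2 ^ (2 * N - 1) := by
    rw [← pow_succ']
    congr 1
    omega
  have hE : ∑ j ∈ range (2 * N + 1), (if j % 2 = 0 then ((2 * N).choose j : ℝ) else 0) =
      2 ^ (2 * N - 1) := by
    rw [hsplit, ← heo, hpow] at htot
    linarith
  rcases Nat.mod_two_eq_zero_or_one N with h0 | h1
  · rw [h0]
    exact hE
  · rw [h1, ← hE, heo]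
    refine sum_congr rfl fun j _ => ?_
    split_ifs with ha hb hb
    · omega
    · rfl
    · rfl
    · omega

/-- The parity sum folded at `j = N`:
`Σ_{j ≤ 2N} [j ≡ N] C(2N, j) = Σ_{x ≤ N} [x even] c_x C(2N, N-x)` with `c_0 = 1`, `c_x = 2` (`x > 0`),
by `C(2N, N+x) = C(2N, N-x)`. [folklore] -/
private theorem sum_parity_choose_fold (N : ℕ) :
    ∑ j ∈ range (2 * N + 1), (if j % 2 = N % 2 then ((2 * N).choose j : ℝ) else 0) =
      ∑ x ∈ range (N + 1),
        (if x % 2 = 0 then (if x = 0 then 1 else 2) * ((2 * N).choose (N - x) : ℝ) else 0) := by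
  have e : 2 * N + 1 = N + (N + 1) := by ring
  rw [e, sum_range_add]
  have h1 : ∑ j ∈ range N, (if j % 2 = N % 2 then ((2 * N).choose j : ℝ) else 0) =
      ∑ x ∈ range (N + 1),
        (if x % 2 = 0 then (if x = 0 then 0 else ((2 * N).choose (N - x) : ℝ)) else 0) := by
    rw [← sum_range_reflect, sum_range_succ']
    simp only [Nat.zero_mod, if_true, add_zero]
    refine sum_congr rfl fun x hx => ?_
    have hx' := mem_range.mp hx
    have e1 : N - 1 - x = N - (x + 1) := by omega
    rw [e1, if_neg (by omega : x + 1 ≠ 0)]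
    by_cases hpar : (x + 1) % 2 = 0
    · rw [if_pos (by omega : (N - (x + 1)) % 2 = N % 2), if_pos hpar]
    · rw [if_neg (by omega : ¬ ((N - (x + 1)) % 2 = N % 2)), if_neg hpar]
  have h2 : ∑ x ∈ range (N + 1), (if (N + x) % 2 = N % 2 then ((2 * N).choose (N + x) : ℝ) else 0) =
      ∑ x ∈ range (N + 1), (if x % 2 = 0 then ((2 * N).choose (N - x) : ℝ) else 0) := by
    refine sum_congr rfl fun x hx => ?_
    have hx' := mem_range.mp hx
    have hsymm : (2 * N).choose (N + x) = (2 * N).choose (N - x) := by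
      rw [← Nat.choose_symm (show N - x ≤ 2 * N by omega)]
      congr 1
      omega
    by_cases hpar : x % 2 = 0
    · rw [if_pos (by omega : (N + x) % 2 = N % 2), if_pos hpar, hsymm]
    · rw [if_neg (by omega : ¬ ((N + x) % 2 = N % 2)), if_neg hpar]
  rw [h1, h2, ← sum_add_distrib]
  refine sum_congr rfl fun x _ => ?_
  split_ifs <;> ring

/-- Re-indexing the even `x ≤ N` as `x = 2m`. [folklore] -/
private theorem sum_even_eq_sum_double (N : ℕ) (h : ℕ → ℝ) :
    ∑ x ∈ range (N + 1), (if x % 2 = 0 then h x else 0) =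
      ∑ m ∈ range (N + 1), (if 2 * m ≤ N then h (2 * m) else 0) := by
  rw [← sum_filter, ← sum_filter]
  have hs : (range (N + 1)).filter (fun x => x % 2 = 0) =
      ((range (N + 1)).filter (fun m => 2 * m ≤ N)).image (fun m => 2 * m) := by
    ext x
    simp only [Finset.mem_filter, Finset.mem_range, Finset.mem_image]
    constructor
    · rintro ⟨hx, hpar⟩
      exact ⟨x / 2, ⟨by omega, by omega⟩, by omega⟩
    · rintro ⟨m, ⟨hm, hle⟩, rfl⟩
      exact ⟨by omega, by omega⟩
  rw [hs, sum_image]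
  intro a _ b _ hab
  simp only at hab
  omega

/-! ### 4. The OPE coefficients and the degree-by-degree identity -/

/-- **The squared OPE coefficients of the free massless scalar in `d = 3`** in the normalisation of the
typed blocks (`k_{ℓ,0} = 1`, Dolan–Osborn): the spin-`2m` conserved current `J_{2m} = φ ∂^{2m} φ` of
dimension `2m + 1` enters `φ × φ` with `λ²_{φφJ_{2m}} = 2^{1-4m} (2 - δ_{m,0}) λ_{2m}`,
`λ_i = C(2i,i)/4^i`; `m = 0` is `φ²` (`Δ = 1`, coefficient `2`), `m = 1` the stress tensor
(coefficient `3/32`). These are the mean-field-theory coefficients `2 (Δ_φ)_ℓ²/(ℓ! (2Δ_φ+ℓ-1)_ℓ)` of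
Fitzpatrick–Kaplan 2012 §2.2 at `Δ_φ = 1/2`, `d = 3`, `n = 0` (`= 4 λ_ℓ/4^ℓ` for `ℓ ≥ 1`), in the
normalisation `k_{ℓ,0} = 1` of the typed blocks. [cite: FitzpatrickKaplan2012, §2.2] -/
noncomputable def freeScalarOPECoeffSq (m : ℕ) : ℝ :=
  (if m = 0 then 2 else 4) * legendreLam (2 * m) / 4 ^ (2 * m)

/-- The squared OPE coefficients are positive. [folklore] -/
theorem freeScalarOPECoeffSq_pos (m : ℕ) : 0 < freeScalarOPECoeffSq m := by
  unfold freeScalarOPECoeffSq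
  have := legendreLam_pos (2 * m)
  split_ifs <;> positivity

/-- `λ²_{φφ φ²} = 2`. [folklore] -/
theorem freeScalarOPECoeffSq_zero : freeScalarOPECoeffSq 0 = 2 := by
  simp [freeScalarOPECoeffSq]

/-- `λ_2 = 3/8`. [folklore] -/
theorem legendreLam_two : legendreLam 2 = 3 / 8 := by
  have h := legendreLam_succ 1
  rw [legendreLam_one] at h
  norm_num at h
  exact h

/-- `λ²_{φφT} = 3/32` (the stress tensor, `m = 1`). [folklore] -/
theorem freeScalarOPECoeffSq_one : freeScalarOPECoeffSq 1 = 3 / 32 := by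
  simp only [freeScalarOPECoeffSq, if_neg one_ne_zero, mul_one, legendreLam_two]
  norm_num

/-- **The degree-`N` identity**: `Σ_{2m ≤ N} λ²_{2m} A_{N-2m,N}(2m+1,2m)/λ_{2m} = 1 + δ_{N,0}`, i.e.
`Σ_{2m ≤ N} c_m C(2N, N-2m) = 4^N (1 + δ_{N,0})` with `c_0 = 2`, `c_m = 4` — the binomial parity identity
`Σ_{j ≡ N (2)} C(2N, j) = 2^{2N-1}`. This is the coefficient of `λ_i λ_k z^i z̄^k`, `i + k = N`, in
`1 + (1-z)^{-1/2}(1-z̄)^{-1/2} = Σ_m λ²_{2m} K_{2m+1,2m}(z,z̄)`. [folklore] -/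
theorem freeScalar_degree_identity (N : ℕ) :
    ∑ m ∈ range (N + 1), freeScalarOPECoeffSq m *
        (if 2 * m ≤ N then
          hrCoeff (((2 * m : ℕ) : ℝ) + 1) (2 * m) (N - 2 * m) N / legendreLam (2 * m) else 0) =
      if N = 0 then 2 else 1 := by
  have h4N : (0 : ℝ) < 4 ^ N := by positivity
  -- each term in closed form
  have hterm : ∀ m ∈ range (N + 1), freeScalarOPECoeffSq m *
      (if 2 * m ≤ N then
        hrCoeff (((2 * m : ℕ) : ℝ) + 1) (2 * m) (N - 2 * m) N / legendreLam (2 * m) else 0) =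
      (if 2 * m ≤ N then (if 2 * m = 0 then 2 else 4) * ((2 * N).choose (N - 2 * m) : ℝ) else 0) / 4 ^ N := by
    intro m _
    by_cases hle : 2 * m ≤ N
    · obtain ⟨n, hn⟩ := Nat.exists_eq_add_of_le hle
      have e1 : N - 2 * m = n := by omega
      have hA : hrCoeff (((2 * m : ℕ) : ℝ) + 1) (2 * m) (N - 2 * m) N =
          ((2 * N).choose (N - 2 * m) : ℝ) / 4 ^ n := by
        rw [e1, hn, hrCoeff_bound_leading (2 * m) n]
        have e2 : 2 * (2 * m) + 2 * n = 2 * (2 * m + n) := by ring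
        rw [e2]
      have hl := legendreLam_pos (2 * m)
      have h4 : (4 : ℝ) ^ N = 4 ^ (2 * m) * 4 ^ n := by rw [← pow_add, hn]
      rw [if_pos hle, if_pos hle, hA, freeScalarOPECoeffSq, h4]
      by_cases h0 : m = 0
      · rw [if_pos h0, if_pos (by omega)]
        field_simp
      · rw [if_neg h0, if_neg (by omega)]
        field_simp
    · rw [if_neg hle, if_neg hle]
      simp
  rw [sum_congr rfl hterm, ← sum_div]
  -- the combinatorial sum
  rcases Nat.eq_zero_or_pos N with h0 | hpos
  · subst h0
    simp
  · rw [if_neg hpos.ne']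
    have hsum : ∑ m ∈ range (N + 1),
        (if 2 * m ≤ N then (if 2 * m = 0 then 2 else 4) * ((2 * N).choose (N - 2 * m) : ℝ) else 0) =
        2 * 2 ^ (2 * N - 1) := by
      rw [← sum_parity_choose hpos.ne', sum_parity_choose_fold,
        sum_even_eq_sum_double N (fun x => (if x = 0 then 1 else 2) * ((2 * N).choose (N - x) : ℝ)),
        mul_sum]
      refine sum_congr rfl fun m _ => ?_
      split_ifs <;> ring
    have e : (2 : ℝ) * 2 ^ (2 * N - 1) = 4 ^ N := by
      rw [← pow_succ', show 2 * N - 1 + 1 = 2 * N by omega, pow_mul]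
      norm_num
    rw [hsum, e, div_self h4N.ne']

/-! ### 5. The decomposition `1 + (1-z)^{-1/2}(1-z̄)^{-1/2} = Σ_m λ²_{2m} K_{2m+1,2m}(z,z̄)` -/

/-- **The conformal block decomposition of the free scalar, `z`-series form**: for `z, z̄ ∈ (0,1)`,
`Σ_m λ²_{2m} K^{HR}_{2m+1,2m}(z,z̄) = (1-z)^{-1/2}(1-z̄)^{-1/2} + 1`, the sum converging (absolutely: all
terms are non-negative). Proof: Tonelli on the non-negative family `λ²_{2m} k^{(2m)}_p z^{p₁} z̄^{p₂}`,
the degree identity `freeScalar_degree_identity` and `Σ_i λ_i x^i = (1-x)^{-1/2}`.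
[cite: DolanOsborn2011, §6 eq. (6.20)] -/
theorem hasSum_freeScalar_series {z zb : ℝ} (hz : z ∈ Ioo (0 : ℝ) 1) (hzb : zb ∈ Ioo (0 : ℝ) 1) :
    HasSum (fun m : ℕ => freeScalarOPECoeffSq m * hrSeries (((2 * m : ℕ) : ℝ) + 1) (2 * m) z zb)
      (1 / (1 - z) ^ ((1 : ℝ) / 2) * (1 / (1 - zb) ^ ((1 : ℝ) / 2)) + 1) := by
  -- the non-negative family on `(ℕ × ℕ) × ℕ` and its fibre sums over the spin index
  set F : (ℕ × ℕ) × ℕ → ℝ := fun pm => freeScalarOPECoeffSq pm.2 *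
    (hrMonomialCoeff (((2 * pm.2 : ℕ) : ℝ) + 1) (2 * pm.2) pm.1 * z ^ pm.1.1 * zb ^ pm.1.2) with hF
  set V : ℕ × ℕ → ℝ := fun p => (if p.1 + p.2 = 0 then 2 else 1) *
    (legendreLam p.1 * legendreLam p.2 * z ^ p.1 * zb ^ p.2) with hV
  have hinner : ∀ p : ℕ × ℕ, HasSum (fun m => F (p, m)) (V p) := by
    intro p
    have hzero : ∀ m ∉ range (p.1 + p.2 + 1), F (p, m) = 0 := by
      intro m hm
      have hm' : p.1 + p.2 < 2 * m := by
        have := mem_range.not.mp hm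
        omega
      simp only [hF, hrMonomialCoeff_bound, if_neg (not_le.mpr hm')]
      ring
    have hfin : HasSum (fun m => F (p, m)) (∑ m ∈ range (p.1 + p.2 + 1), F (p, m)) :=
      hasSum_sum_of_ne_finset_zero hzero
    have hval : ∑ m ∈ range (p.1 + p.2 + 1), F (p, m) = V p := by
      have hterm : ∀ m ∈ range (p.1 + p.2 + 1), F (p, m) =
          freeScalarOPECoeffSq m * (if 2 * m ≤ p.1 + p.2 then
            hrCoeff (((2 * m : ℕ) : ℝ) + 1) (2 * m) (p.1 + p.2 - 2 * m) (p.1 + p.2) / legendreLam (2 * m)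
            else 0) * (legendreLam p.1 * legendreLam p.2 * z ^ p.1 * zb ^ p.2) := by
        intro m _
        simp only [hF, hrMonomialCoeff_bound]
        split_ifs <;> ring
      rw [sum_congr rfl hterm, ← sum_mul, freeScalar_degree_identity]
    rwa [hval] at hfin
  -- the fibre sums form the Cauchy square of `Σ λ_i x^i` plus the identity term
  have hVsum : HasSum V (1 / (1 - z) ^ ((1 : ℝ) / 2) * (1 / (1 - zb) ^ ((1 : ℝ) / 2)) + 1) := by
    have h1 := hasSum_legendreLam_mul_pow (x := z) (by rw [abs_of_pos hz.1]; exact hz.2)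
    have h2 := hasSum_legendreLam_mul_pow (x := zb) (by rw [abs_of_pos hzb.1]; exact hzb.2)
    have hnn1 : 0 ≤ fun n => legendreLam n * z ^ n := fun n =>
      mul_nonneg (legendreLam_pos n).le (pow_nonneg hz.1.le n)
    have hnn2 : 0 ≤ fun n => legendreLam n * zb ^ n := fun n =>
      mul_nonneg (legendreLam_pos n).le (pow_nonneg hzb.1.le n)
    have hprod := h1.mul h2 (h1.summable.mul_of_nonneg h2.summable hnn1 hnn2)
    have hδ : HasSum (fun p : ℕ × ℕ => if p = (0, 0) then (1 : ℝ) else 0) 1 := hasSum_ite_eq (0, 0) 1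
    have hVeq : V = fun p : ℕ × ℕ =>
        legendreLam p.1 * z ^ p.1 * (legendreLam p.2 * zb ^ p.2) + (if p = (0, 0) then (1 : ℝ) else 0) := by
      funext p
      obtain ⟨i, k⟩ := p
      simp only [hV]
      by_cases h0 : i + k = 0
      · have hi : i = 0 := by omega
        have hk : k = 0 := by omega
        subst hi hk
        simp
        norm_num
      · rw [if_neg h0, if_neg (by simp only [Prod.mk.injEq]; omega)]
        ring
    rw [hVeq]
    exact hprod.add hδ
  -- Tonelli: the family is summable, with total the sum of the fibre sums
  have hFnn : 0 ≤ F := by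
    intro pm
    simp only [hF, Pi.zero_apply]
    exact mul_nonneg (freeScalarOPECoeffSq_pos _).le (mul_nonneg (mul_nonneg
      (hrMonomialCoeff_bound_nonneg _ _) (pow_nonneg hz.1.le _)) (pow_nonneg hzb.1.le _))
  have hFsum : Summable F := by
    refine (summable_prod_of_nonneg hFnn).mpr ⟨fun p => (hinner p).summable, ?_⟩
    have : (fun p : ℕ × ℕ => ∑' m, F (p, m)) = V := funext fun p => (hinner p).tsum_eq
    rw [this]
    exact hVsum.summable
  have htot : HasSum F (∑' pm, F pm) := hFsum.hasSum
  have hval : ∑' pm, F pm = 1 / (1 - z) ^ ((1 : ℝ) / 2) * (1 / (1 - zb) ^ ((1 : ℝ) / 2)) + 1 :=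
    (htot.prod_fiberwise hinner).unique hVsum
  -- and, summing the other way, the total is `Σ_m λ²_{2m} K_{2m+1,2m}(z,z̄)`
  have hswap : HasSum (fun mp : ℕ × (ℕ × ℕ) => F (mp.2, mp.1)) (∑' pm, F pm) :=
    (Equiv.prodComm ℕ (ℕ × ℕ)).hasSum_iff.mpr htot
  have hrow : ∀ m : ℕ, HasSum (fun p : ℕ × ℕ => F (p, m))
      (freeScalarOPECoeffSq m * hrSeries (((2 * m : ℕ) : ℝ) + 1) (2 * m) z zb) := fun m =>
    (hasSum_hrSeries_bound (2 * m) hz hzb).mul_left (freeScalarOPECoeffSq m)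
  rw [← hval]
  exact hswap.prod_fiberwise hrow

/-- **The identity-subtracted four-point function of the free massless scalar `φ` in `d = 3`** in the
`⟨σσσσ⟩` conventions of the `σ–ε` system: `⟨φφφφ⟩ = (x₁₂² x₃₄²)^{-1/2} 𝒢(u,v)`,
`𝒢(u,v) = 1 + u^{1/2} + (u/v)^{1/2}`, so `𝒢 - 1 = (z z̄)^{1/2} (1 + ((1-z)(1-z̄))^{-1/2})`
(`u = z z̄`, `v = (1-z)(1-z̄)`). [folklore] -/
noncomputable def freeScalarCorrelator (z zb : ℝ) : ℝ :=
  (z * zb) ^ ((1 : ℝ) / 2) * (1 + 1 / ((1 - z) * (1 - zb)) ^ ((1 : ℝ) / 2))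

/-- **The conformal block decomposition of the free scalar four-point function in `d = 3`**: on the open
square, `𝒢(z,z̄) - 1 = Σ_{m ≥ 0} λ²_{2m} g_{2m+1, 2m}(z,z̄)` with the typed blocks `hrBlock (2m+1) (2m)`
(`φ²` at `m = 0`, the conserved currents `J_{2m}` at the unitarity bound for `m ≥ 1`) and the
coefficients `freeScalarOPECoeffSq`. [cite: DolanOsborn2011, §6 eq. (6.20)] -/
theorem hasSum_freeScalar_blocks {z zb : ℝ} (hz : z ∈ Ioo (0 : ℝ) 1) (hzb : zb ∈ Ioo (0 : ℝ) 1) :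
    HasSum (fun m : ℕ => freeScalarOPECoeffSq m * hrBlock (2 * (m : ℝ) + 1) (2 * m) z zb)
      (freeScalarCorrelator z zb) := by
  have h := (hasSum_freeScalar_series hz hzb).mul_left ((z * zb) ^ ((1 : ℝ) / 2))
  have hfun : (fun m : ℕ => freeScalarOPECoeffSq m * hrBlock (2 * (m : ℝ) + 1) (2 * m) z zb) =
      fun m => (z * zb) ^ ((1 : ℝ) / 2) *
        (freeScalarOPECoeffSq m * hrSeries (((2 * m : ℕ) : ℝ) + 1) (2 * m) z zb) := by
    funext m
    unfold hrBlock
    have e1 : (2 * (m : ℝ) + 1 - ((2 * m : ℕ) : ℝ)) / 2 = (1 : ℝ) / 2 := by push_cast; ring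
    have e2 : (2 * (m : ℝ) + 1) = (((2 * m : ℕ) : ℝ) + 1) := by push_cast; ring
    rw [e1, e2]
    ring
  have hval : freeScalarCorrelator z zb = (z * zb) ^ ((1 : ℝ) / 2) *
      (1 / (1 - z) ^ ((1 : ℝ) / 2) * (1 / (1 - zb) ^ ((1 : ℝ) / 2)) + 1) := by
    unfold freeScalarCorrelator
    rw [Real.mul_rpow (x := 1 - z) (y := 1 - zb) (sub_nonneg.mpr hz.2.le) (sub_nonneg.mpr hzb.2.le)]
    ring
  rw [hfun, hval]
  exact h

/-- The decomposition converges in particular on the diagonal (the convergence clause of A1). [folklore] -/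
theorem summable_freeScalar_blocks_diag {x : ℝ} (hx0 : 0 < x) (hx1 : x < 1) :
    Summable (fun m : ℕ => freeScalarOPECoeffSq m * hrBlock (2 * (m : ℝ) + 1) (2 * m) x x) :=
  (hasSum_freeScalar_blocks ⟨hx0, hx1⟩ ⟨hx0, hx1⟩).summable

end Literature.MathematicalPhysics.QuantumFieldTheory.ConformalBootstrap3D
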